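import Summits.AtomisticToContinuum.Crystallization.Theorems.SquareWellLayerCakeStackingFaultSparsityOfLaminarBarlowWindows

/-!
# Route `SquareWellLayerCake` without its rank-5 crux: `StackingFaultSparsity` (and the route's
conclusion) from K1–K3 alone

The deciding theorem `Theses.SquareWellLayerCake.closes` takes the four route items
`AveragedTwelve` (K1), `TwelveWithinOne` (K2), `GapTwelveToBarlow` (K3) and `StackingFaultSparsity`
(stmt-AtomisticToContinuum-14296) and derives `LaminarBarlowWindows` from K1–K3 on the way (its Steps 1–2).
The checked line `Sketch` of the crux has landed `StackingFaultSparsity_of_laminarBarlowWindows :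
LaminarBarlowWindows → StackingFaultSparsity` (file `…OfLaminarBarlowWindows.lean`), so for THIS route the
crux is a consequence of the other three:

* `softTwelve_of_averagedTwelve` — Step 1 of `closes`, verbatim (counting glue: K1 ∧ K2 ⇒ soft twelve
  with gap almost everywhere);
* `laminarBarlowWindows_of_gapTwelve : AveragedTwelve → TwelveWithinOne → GapTwelveToBarlow →
  LaminarBarlowWindows` — Step 2 of `closes`;
* `StackingFaultSparsity_of_gapTwelve : AveragedTwelve → TwelveWithinOne → GapTwelveToBarlow →
  StackingFaultSparsity`;
* `crystallization_of_gapTwelve : AveragedTwelve → TwelveWithinOne → GapTwelveToBarlow → Crystallization`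
  (= `closes` with its fourth hypothesis discharged).

All `[folklore]` glue (planner note D-0014 on the item: the crux may be restated as
`LaminarBarlowWindows → <body>`, or dropped from this route's item list).
-/

noncomputable section

open scoped BigOperators Topology Classical
open Filter

namespace Summit.AtomisticToContinuum.Crystallization.Theorems.SquareWellLayerCake.StackingFaultSparsity.OfLaminarBarlowWindows

/-- **K1 ∧ K2 ⇒ soft twelve with gap, almost everywhere** (Step 1 of `Theses.SquareWellLayerCake.closes`,
verbatim): for every ground-state sequence the fraction of particles that are NOT
(separated-neighbourhood ∧ exactly twelve within `1` ∧ at most twelve within `11/10`) tends to zero.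
Double counting with `AveragedTwelve` on the separated set bounds the `13`-or-more sites by `12×` the
K2-defective ones. [folklore] -/
theorem softTwelve_of_averagedTwelve
    (hK1 : Summit.AtomisticToContinuum.Crystallization.Theses.SquareWellLayerCake.AveragedTwelve)
    (hK2 : Summit.AtomisticToContinuum.Crystallization.Theses.SquareWellLayerCake.TwelveWithinOne) :
    ∀ x : (N : ℕ) → (Fin N → EuclideanSpace ℝ (Fin 3)),
      (∀ N, Literature.MathematicalPhysics.StatisticalMechanics.IsGroundState Literature.MathematicalPhysics.StatisticalMechanics.lennardJones (x N)) →
      Filter.Tendsto (fun N : ℕ => (Nat.card {i : Fin N // ¬ ((∀ j : Fin N, dist (x N i) (x N j) ≤ 11 / 10 →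
        ∀ k : Fin N, k ≠ j → (55 : ℝ) / 57 ≤ dist (x N j) (x N k)) ∧
        (Finset.univ.filter fun j : Fin N => j ≠ i ∧ dist (x N i) (x N j) ≤ 1).card = 12 ∧
        (Finset.univ.filter fun j : Fin N => j ≠ i ∧ dist (x N i) (x N j) ≤ 11 / 10).card ≤ 12)} : ℝ) / N)
        Filter.atTop (nhds 0) := by
  intro x hx
  have h2 := hK2 x hx
  -- pointwise comparison of the two defect counts
  have hle : ∀ N : ℕ, (Nat.card {i : Fin N // ¬ ((∀ j : Fin N, dist (x N i) (x N j) ≤ 11 / 10 →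
      ∀ k : Fin N, k ≠ j → (55 : ℝ) / 57 ≤ dist (x N j) (x N k)) ∧
      (Finset.univ.filter fun j : Fin N => j ≠ i ∧ dist (x N i) (x N j) ≤ 1).card = 12 ∧
      (Finset.univ.filter fun j : Fin N => j ≠ i ∧ dist (x N i) (x N j) ≤ 11 / 10).card ≤ 12)} : ℝ) ≤
      13 * (Nat.card {i : Fin N // ¬ ((∀ j : Fin N, dist (x N i) (x N j) ≤ 11 / 10 →
      ∀ k : Fin N, k ≠ j → (55 : ℝ) / 57 ≤ dist (x N j) (x N k)) ∧
      12 ≤ (Finset.univ.filter fun j : Fin N => j ≠ i ∧ dist (x N i) (x N j) ≤ 1).card)} : ℝ) := by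
    intro N
    classical
    -- abbreviations
    set X : Fin N → EuclideanSpace ℝ (Fin 3) := x N with hXdef
    set Sep : Fin N → Prop := fun j => ∀ k : Fin N, k ≠ j → (55 : ℝ) / 57 ≤ dist (X j) (X k) with hSep
    set Nb : Fin N → Prop := fun i => ∀ j : Fin N, dist (X i) (X j) ≤ 11 / 10 → Sep j with hNb
    set A : Fin N → ℕ := fun i => (Finset.univ.filter fun j : Fin N => j ≠ i ∧ dist (X i) (X j) ≤ 1).card with hA
    set B : Fin N → ℕ := fun i => (Finset.univ.filter fun j : Fin N => j ≠ i ∧ dist (X i) (X j) ≤ 11 / 10).card with hB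
    show (Nat.card {i : Fin N // ¬ (Nb i ∧ A i = 12 ∧ B i ≤ 12)} : ℝ) ≤ 13 * (Nat.card {i : Fin N // ¬ (Nb i ∧ 12 ≤ A i)} : ℝ)
    rw [Nat.card_eq_fintype_card, Fintype.card_subtype, Nat.card_eq_fintype_card, Fintype.card_subtype]
    -- the finsets
    set Gc := Finset.univ.filter fun i : Fin N => ¬ (Nb i ∧ A i = 12 ∧ B i ≤ 12) with hGc
    set Pc := Finset.univ.filter fun i : Fin N => ¬ (Nb i ∧ 12 ≤ A i) with hPc
    set Ps := Finset.univ.filter fun i : Fin N => Nb i ∧ 12 ≤ A i with hPs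
    set Ss := Finset.univ.filter fun i : Fin N => Sep i with hSs
    set Bad := Finset.univ.filter fun i : Fin N => (Nb i ∧ 12 ≤ A i) ∧ 13 ≤ B i with hBad
    -- A ≤ B pointwise
    have hAB : ∀ i, A i ≤ B i := by
      intro i
      simp only [hA, hB]
      apply Finset.card_le_card
      intro j hj
      simp only [Finset.mem_filter, Finset.mem_univ, true_and] at hj ⊢
      exact ⟨hj.1, hj.2.trans (by norm_num)⟩
    -- (1) ¬Good ⊆ ¬Pre ∪ Bad
    have h1 : Gc ⊆ Pc ∪ Bad := by
      intro i hi
      simp only [hGc, hPc, hBad, Finset.mem_filter, Finset.mem_univ, true_and, Finset.mem_union] at hi ⊢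
      by_cases hp : Nb i ∧ 12 ≤ A i
      · right
        refine ⟨hp, ?_⟩
        by_contra hB13
        push Not at hB13
        have hBle : B i ≤ 12 := by omega
        have hAeq : A i = 12 := le_antisymm ((hAB i).trans hBle) hp.2
        exact hi ⟨hp.1, hAeq, hBle⟩
      · left; exact hp
    have h1c : Gc.card ≤ Pc.card + Bad.card := (Finset.card_le_card h1).trans (Finset.card_union_le _ _)
    -- (2) Bad.card ≤ 12 * Pc.card, by double counting with AveragedTwelve on the separated set Ss
    have hPsSs : Ps ⊆ Ss := by
      intro i hi
      simp only [hPs, hSs, Finset.mem_filter, Finset.mem_univ, true_and] at hi ⊢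
      exact hi.1 i (by rw [dist_self]; norm_num)
    -- K1 applied to Ss
    have hsep : ∀ i ∈ Ss, ∀ j ∈ Ss, i ≠ j → (55 : ℝ) / 57 ≤ dist (X i) (X j) := by
      intro i hi j _ hij
      simp only [hSs, Finset.mem_filter, Finset.mem_univ, true_and] at hi
      exact hi j (Ne.symm hij)
    have hK1' := hK1 N X Ss (55 / 57) (11 / 10) (by norm_num) (by norm_num) hsep
    -- C i := count inside Ss
    set C : Fin N → ℕ := fun i => (Ss.filter fun j : Fin N => j ≠ i ∧ dist (X i) (X j) ≤ 11 / 10).card with hC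
    have hBC : ∀ i ∈ Ps, B i ≤ C i := by
      intro i hi
      simp only [hPs, Finset.mem_filter, Finset.mem_univ, true_and] at hi
      simp only [hB, hC]
      apply Finset.card_le_card
      intro j hj
      simp only [Finset.mem_filter, Finset.mem_univ, true_and, hSs] at hj ⊢
      exact ⟨hi.1 j hj.2, hj.1, hj.2⟩
    -- lower bound on the sum over Ps
    have hlow : (Bad.card : ℝ) + 12 * Ps.card ≤ ∑ i ∈ Ps, (B i : ℝ) := by
      have hBadPs : Bad = Ps.filter fun i => 13 ≤ B i := by
        simp only [hBad, hPs, Finset.filter_filter]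
      have hsum1 : (Bad.card : ℝ) = ∑ i ∈ Ps, (if 13 ≤ B i then (1 : ℝ) else 0) := by
        rw [Finset.sum_boole, hBadPs]
      have hsum2 : (12 : ℝ) * Ps.card = ∑ i ∈ Ps, (12 : ℝ) := by
        rw [Finset.sum_const, nsmul_eq_mul, mul_comm]
      rw [hsum1, hsum2, ← Finset.sum_add_distrib]
      apply Finset.sum_le_sum
      intro i hi
      simp only [hPs, Finset.mem_filter, Finset.mem_univ, true_and] at hi
      have h12 : 12 ≤ B i := hi.2.trans (hAB i)
      split_ifs with h13
      · have : (13 : ℝ) ≤ B i := by exact_mod_cast h13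
        linarith
      · have : (12 : ℝ) ≤ B i := by exact_mod_cast h12
        linarith
    -- upper bound on the sum over Ps via K1
    have hup : ∑ i ∈ Ps, (B i : ℝ) ≤ 12 * Ss.card := by
      calc ∑ i ∈ Ps, (B i : ℝ) ≤ ∑ i ∈ Ps, (C i : ℝ) := by
            apply Finset.sum_le_sum
            intro i hi
            exact_mod_cast hBC i hi
        _ ≤ ∑ i ∈ Ss, (C i : ℝ) := by
            apply Finset.sum_le_sum_of_subset_of_nonneg hPsSs
            intro i _ _
            positivity
        _ ≤ 12 * Ss.card := by simpa [hC] using hK1'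
    -- Ss.card ≤ Ps.card + Pc.card (= N)
    have hSsN : (Ss.card : ℝ) ≤ Ps.card + Pc.card := by
      have hN : Ps.card + Pc.card = Fintype.card (Fin N) := by
        simp only [hPs, hPc]
        exact Finset.card_filter_add_card_filter_not _
      have : Ss.card ≤ Fintype.card (Fin N) := Finset.card_le_univ _
      exact_mod_cast (this.trans hN.ge)
    have h2c : (Bad.card : ℝ) ≤ 12 * Pc.card := by nlinarith [hlow, hup, hSsN]
    have h1c' : (Gc.card : ℝ) ≤ Pc.card + Bad.card := by exact_mod_cast h1c
    linarith
  have h13 : Filter.Tendsto (fun N : ℕ => 13 * ((Nat.card {i : Fin N // ¬ ((∀ j : Fin N, dist (x N i) (x N j) ≤ 11 / 10 →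
      ∀ k : Fin N, k ≠ j → (55 : ℝ) / 57 ≤ dist (x N j) (x N k)) ∧
      12 ≤ (Finset.univ.filter fun j : Fin N => j ≠ i ∧ dist (x N i) (x N j) ≤ 1).card)} : ℝ) / N))
      Filter.atTop (nhds 0) := by
    simpa using h2.const_mul 13
  refine squeeze_zero (fun N => by positivity) (fun N => ?_) h13
  rw [mul_div_assoc']
  exact div_le_div_of_nonneg_right (hle N) (Nat.cast_nonneg N)

/-- **K1–K3 ⇒ `LaminarBarlowWindows`** (Step 2 of `Theses.SquareWellLayerCake.closes`: K3 turns soft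
twelve with gap into Barlow windows almost everywhere). [folklore] -/
theorem laminarBarlowWindows_of_gapTwelve
    (hK1 : Summit.AtomisticToContinuum.Crystallization.Theses.SquareWellLayerCake.AveragedTwelve)
    (hK2 : Summit.AtomisticToContinuum.Crystallization.Theses.SquareWellLayerCake.TwelveWithinOne)
    (hK3 : Summit.AtomisticToContinuum.Crystallization.Theses.SquareWellLayerCake.GapTwelveToBarlow) :
    Summit.AtomisticToContinuum.Crystallization.Theses.SquareWellLayerCake.LaminarBarlowWindows := by
  intro R ε hR hε hε' x hx
  exact hK3 x hx (softTwelve_of_averagedTwelve hK1 hK2 x hx) R ε hR hε hε'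

/-- **K1–K3 ⇒ `StackingFaultSparsity`** (route `SquareWellLayerCake`): the rank-5 crux
stmt-AtomisticToContinuum-14296 follows from the route's other three cruxes, through
`LaminarBarlowWindows` and the landed line `Sketch`. [folklore] -/
theorem StackingFaultSparsity_of_gapTwelve :
    Summit.AtomisticToContinuum.Crystallization.Theses.SquareWellLayerCake.AveragedTwelve →
    Summit.AtomisticToContinuum.Crystallization.Theses.SquareWellLayerCake.TwelveWithinOne →
    Summit.AtomisticToContinuum.Crystallization.Theses.SquareWellLayerCake.GapTwelveToBarlow →
      Summit.AtomisticToContinuum.Crystallization.Theses.SquareWellLayerCake.StackingFaultSparsity :=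
  fun hK1 hK2 hK3 =>
    StackingFaultSparsity_of_laminarBarlowWindows (laminarBarlowWindows_of_gapTwelve hK1 hK2 hK3)

/-- **Route `SquareWellLayerCake` closes from K1–K3 alone**: `closes` with its fourth hypothesis
`StackingFaultSparsity` discharged by `StackingFaultSparsity_of_gapTwelve`. [folklore] -/
theorem crystallization_of_gapTwelve
    (hK1 : Summit.AtomisticToContinuum.Crystallization.Theses.SquareWellLayerCake.AveragedTwelve)
    (hK2 : Summit.AtomisticToContinuum.Crystallization.Theses.SquareWellLayerCake.TwelveWithinOne)
    (hK3 : Summit.AtomisticToContinuum.Crystallization.Theses.SquareWellLayerCake.GapTwelveToBarlow) :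
    _root_.Crystallization :=
  Summit.AtomisticToContinuum.Crystallization.Theses.SquareWellLayerCake.closes hK1 hK2 hK3
    (StackingFaultSparsity_of_gapTwelve hK1 hK2 hK3)

end Summit.AtomisticToContinuum.Crystallization.Theorems.SquareWellLayerCake.StackingFaultSparsity.OfLaminarBarlowWindows

end
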